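import Literature.AnabelianGeometry.EtaleTheta.EtaleThetaClass
import Literature.AnabelianGeometry.EtaleTheta.ThetaCyclotomes
import HarnessLib

/-!
# [EtTh] §2 over §1: the quotient `Δ̄_X` of `Δ^Θ_X` by `l`-th powers, its kernel and the preimage of
# `Δ̄_Θ`, at the §1 theta setting (W3-L2-02 phase 1: model definitions for `ThetaCovers.CoverData`)

Mochizuki, *The étale theta function and its Frobenioid-theoretic manifestations*, Publ. RIMS **45**
(2009), §2, the un-numbered discussion preceding Def. 2.1, PRIMS PDF p. 35 (printed 261): "Write `Δ̄_X`
for the quotient of `Δ^Θ_X` by the subgroup generated by `l`-th powers of elements of `Δ^Θ_X`. Then we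
have a natural exact sequence `1 → Δ̄_Θ → Δ̄_X → Δ̄^ell_X → 1`, where `Δ̄_Θ ≅ (ℤ/lℤ)(1)`; `Δ̄^ell_X` is a
free `(ℤ/lℤ)`-module of rank `2`", and "we shall write `Π_X ↠ Π̄_X` for the quotient whose kernel is
the kernel of the quotient `Δ_X ↠ Δ̄_X`" [cite: MochizukiEtTh2009, Def 2.1 p.35].

Cell abc-iut, layer L2, plan/L2/ASSIGNMENTS.md §J row W3-L2-02 («§2 COVER/ORBIT MODEL», seat
abc-iut-L2-d3), PHASE 1 (L2-lead ruling 2026-08-26T02:06:46Z (C)): the MODEL-LEVEL definitions that the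
fields `barKer`, `barTheta`, `barTheta_central`, `pow_mem_barKer` of seat abc-iut-L2-t2's interface
`ThetaCovers.CoverData` / `CoverDataAx` (`ThetaCovers.lean`, `ThetaCoversAxioms.lean`) name, written over
the §1 root `ThetaSetting` (seat abc-iut-L2-t1) at the TEMPERED level — `Δ^Θ_X` is realised, as
everywhere in the §1 model, by the image `(Δ^tp_X)^Θ` of `Δ^tp_X` in the theta quotient
`(Π^tp_X)^Θ = GtpTheta` (root fields `toTheta`, `ker_toTheta`, `ker_toEll`, `ker_thetaToEll_central`):

* `ThetaSetting.DtpTheta` — `(Δ^tp_X)^Θ`, the image of `Δ^tp_X` in `(Π^tp_X)^Θ` (p. 12);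
* `ThetaSetting.powTheta l` — "the subgroup generated by `l`-th powers of elements of `Δ^Θ_X`" (p. 35);
* `ThetaSetting.barKerTp l` — `Ker(Δ^tp_X ↠ Δ̄_X)`, as a subgroup of `Π^tp_X`;
* `ThetaSetting.barThetaTp l` — the inverse image in `Δ^tp_X` of `Δ̄_Θ ⊆ Δ̄_X`, i.e. of `Δ_Θ · ⟨l-th powers⟩`.

PROVED here (pure group theory of the class-two quotient `Δ^Θ_X = Δ_X/[Δ_X,[Δ_X,Δ_X]]`, p. 12):
commutators of `(Δ^tp_X)^Θ` lie in `Δ_Θ` and are central; `⟨l-th powers⟩` is normal in `(Π^tp_X)^Θ` and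
absorbs commutators with `(Δ^tp_X)^Θ` (`[t^l, d] = [t, d]^l`); hence `Ker(Δ^tp_X ↠ Δ̄_X) ⊆`
(preimage of `Δ̄_Θ`) `⊆ Δ^tp_X` are normal in `Π^tp_X`, every `l`-th power of `Δ^tp_X` lies in the kernel
(`CoverDataAx.pow_mem_barKer` at the model) and `Δ̄_Θ` is central in `Δ̄_X`
(`CoverData.barTheta_central` at the model). NOT here (phase 1 continued / phase 2): the index
statements `#Δ̄_Θ = l`, `Δ̄^ell_X ≅ (ℤ/lℤ)²` (from `IsEtThOrigin`), the transport to the profinite `Π_C`,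
and anything involving `Π^tp_C` (inputs P-C1…P-C8 of HOME/…/W3-L2-02-CENSUS.md). Nothing here asserts
that a `ThetaSetting` exists; typed ≠ endorsed; no side is taken on any disputed claim.
-/

noncomputable section

namespace Literature.AnabelianGeometry.EtaleTheta

open Literature.AnabelianGeometry.SemiGraphs

namespace ThetaSetting

variable {p : ℕ} [Fact p.Prime] (D : ThetaSetting p)

/-! ### `(Δ^tp_X)^Θ` and its class-two structure -/

/-- `(Δ^tp_X)^Θ ⊆ (Π^tp_X)^Θ`: the image of the geometric tempered fundamental group `Δ^tp_X` in the theta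
quotient ("the quotients `Δ^tp_X ↠ (Δ^tp_X)^Θ ↠ (Δ^tp_X)^ell`", p. 12). [cite: MochizukiEtTh2009, §1 p.12] -/
abbrev DtpTheta : Subgroup D.GtpTheta := D.DeltaTemp.map D.toTheta

/-- `(Δ^tp_X)^Θ` is normal in `(Π^tp_X)^Θ` (image of the normal subgroup `Δ^tp_X` under the surjection
`Π^tp_X ↠ (Π^tp_X)^Θ`). [cite: MochizukiEtTh2009, §1 p.12] -/
theorem dtpTheta_normal : D.DtpTheta.Normal :=
  Subgroup.Normal.map (MonoidHom.normal_ker D.aug.toMonoidHom : D.DeltaTemp.Normal) D.toTheta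
    D.toTheta_surjective

/-- `Δ_Θ ⊆ (Δ^tp_X)^Θ` (`Δ_Θ` "the image of `∧² Δ^ell_X` in `Δ^Θ_X`", p. 12): the kernel of
`(Π^tp_X)^Θ ↠ (Π^tp_X)^ell` lies in the image of `Δ^tp_X`, since `Ker(Π^tp_X ↠ (Π^tp_X)^ell) ⊆ Δ^tp_X`
(`ker_toEll_le_deltaTemp`). [cite: MochizukiEtTh2009, §1 p.12] -/
theorem deltaTheta_le_dtpTheta : D.DeltaTheta ≤ D.DtpTheta := by
  intro z hz
  obtain ⟨x, rfl⟩ := D.toTheta_surjective z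
  exact ⟨x, D.ker_toEll_le_deltaTemp (by change D.thetaToEll (D.toTheta x) = 1; exact hz), rfl⟩

/-- **Commutators of `(Δ^tp_X)^Θ` lie in `Δ_Θ`** (`Δ^Θ_X ↠ Δ^ell_X = Δ^ab_X` has kernel `Δ_Θ`, p. 12): for
`s, t ∈ (Δ^tp_X)^Θ`, `s t s⁻¹ t⁻¹ ∈ Δ_Θ` — from the root field `ker_toEll` (the kernel of
`Π^tp_X ↠ (Π^tp_X)^ell` is the pull-back of `[Δ_X, Δ_X]⁻`). [cite: MochizukiEtTh2009, §1 p.12] -/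
theorem commutator_mem_deltaTheta {s t : D.GtpTheta} (hs : s ∈ D.DtpTheta) (ht : t ∈ D.DtpTheta) :
    s * t * s⁻¹ * t⁻¹ ∈ D.DeltaTheta := by
  obtain ⟨x, hx, rfl⟩ := hs
  obtain ⟨y, hy, rfl⟩ := ht
  have hx' : D.toHat.toMonoidHom x ∈ D.DeltaHat := by
    rw [← D.comap_toHat_deltaHat] at hx; exact hx
  have hy' : D.toHat.toMonoidHom y ∈ D.DeltaHat := by
    rw [← D.comap_toHat_deltaHat] at hy; exact hy
  have hmem : x * y * x⁻¹ * y⁻¹ ∈ (D.thetaToEll.comp D.toTheta).ker := by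
    rw [D.ker_toEll, Subgroup.mem_comap, map_mul, map_mul, map_mul, map_inv, map_inv]
    have h := Subgroup.commutator_mem_commutator hx' hy'
    rw [commutatorElement_def] at h
    exact Subgroup.le_topologicalClosure _ h
  have h2 : D.toTheta (x * y * x⁻¹ * y⁻¹) ∈ D.DeltaTheta := hmem
  simpa only [map_mul, map_inv] using h2

/-- `Δ_Θ` is central in `(Δ^tp_X)^Θ` (root field `ker_thetaToEll_central`; `Δ^Θ_X` is a central
extension, p. 12): `z d = d z` for `z ∈ Δ_Θ`, `d ∈ (Δ^tp_X)^Θ`. [cite: MochizukiEtTh2009, §1 p.12] -/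
theorem deltaTheta_comm_dtpTheta {z d : D.GtpTheta} (hz : z ∈ D.DeltaTheta) (hd : d ∈ D.DtpTheta) :
    z * d = d * z :=
  D.ker_thetaToEll_central z hz d hd

/-- In the class-two group `(Δ^tp_X)^Θ`: `t^n d = [t,d]^n d t^n` with `[t,d] = t d t⁻¹ d⁻¹ ∈ Δ_Θ` central
— the commutator of a power is the power of the commutator. [cite: MochizukiEtTh2009, §1 p.12] -/
theorem pow_mul_eq_commutator_pow_mul {t d : D.GtpTheta} (ht : t ∈ D.DtpTheta) (hd : d ∈ D.DtpTheta)
    (n : ℕ) : t ^ n * d = (t * d * t⁻¹ * d⁻¹) ^ n * d * t ^ n := by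
  set c := t * d * t⁻¹ * d⁻¹ with hc
  have hcΘ : c ∈ D.DeltaTheta := D.commutator_mem_deltaTheta ht hd
  have hct : c * t = t * c := D.deltaTheta_comm_dtpTheta hcΘ ht
  have htd : t * d = c * d * t := by rw [hc]; group
  induction n with
  | zero => simp
  | succ n ih =>
    calc t ^ (n + 1) * d = t * (t ^ n * d) := by rw [pow_succ']; group
      _ = t * ((c ^ n * d) * t ^ n) := by rw [ih, mul_assoc]
      _ = (t * c ^ n) * d * t ^ n := by group
      _ = (c ^ n * t) * d * t ^ n := by
            have hcomm : Commute t c := hct.symm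
            rw [(hcomm.pow_right n).eq]
      _ = c ^ n * (t * d) * t ^ n := by group
      _ = c ^ n * (c * d * t) * t ^ n := by rw [htd]
      _ = c ^ (n + 1) * d * t ^ (n + 1) := by rw [pow_succ, pow_succ]; group

/-- `[t^n, d] = [t, d]^n` in `(Δ^tp_X)^Θ`. [cite: MochizukiEtTh2009, §1 p.12] -/
theorem commutator_pow_left {t d : D.GtpTheta} (ht : t ∈ D.DtpTheta) (hd : d ∈ D.DtpTheta) (n : ℕ) :
    t ^ n * d * (t ^ n)⁻¹ * d⁻¹ = (t * d * t⁻¹ * d⁻¹) ^ n := by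
  rw [D.pow_mul_eq_commutator_pow_mul ht hd n]
  group

/-! ### The subgroup generated by `l`-th powers -/

/-- **"The subgroup generated by `l`-th powers of elements of `Δ^Θ_X`"** (p. 35), inside `(Π^tp_X)^Θ`:
the subgroup of `(Δ^tp_X)^Θ` generated by `{t^l : t ∈ (Δ^tp_X)^Θ}`. [cite: MochizukiEtTh2009, Def 2.1 p.35] -/
def powTheta (l : ℕ) : Subgroup D.GtpTheta :=
  Subgroup.closure ((fun t : D.GtpTheta => t ^ l) '' (D.DtpTheta : Set D.GtpTheta))

variable (l : ℕ)

/-- `⟨l-th powers⟩ ⊆ (Δ^tp_X)^Θ`. [cite: MochizukiEtTh2009, Def 2.1 p.35] -/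
theorem powTheta_le_dtpTheta : D.powTheta l ≤ D.DtpTheta := by
  refine (Subgroup.closure_le _).2 ?_
  rintro _ ⟨t, ht, rfl⟩
  exact pow_mem ht l

/-- `t^l ∈ ⟨l-th powers⟩` for `t ∈ (Δ^tp_X)^Θ`. [cite: MochizukiEtTh2009, Def 2.1 p.35] -/
theorem pow_mem_powTheta {t : D.GtpTheta} (ht : t ∈ D.DtpTheta) : t ^ l ∈ D.powTheta l :=
  Subgroup.subset_closure ⟨t, ht, rfl⟩

/-- `l·Δ_Θ ⊆ ⟨l-th powers⟩` (`l · Δ_Θ`, p. 45, is generated by `l`-th powers of elements of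
`Δ_Θ ⊆ (Δ^tp_X)^Θ`). [cite: MochizukiEtTh2009, Prop 2.12 (i) p.45] -/
theorem lDeltaTheta_le_powTheta : D.lDeltaTheta l ≤ D.powTheta l := by
  rintro _ ⟨a, ha, rfl⟩
  exact D.pow_mem_powTheta l (D.deltaTheta_le_dtpTheta ha)

/-- `⟨l-th powers⟩` is normal in `(Π^tp_X)^Θ` (the generating set is conjugation-invariant:
`g t^l g⁻¹ = (g t g⁻¹)^l` and `(Δ^tp_X)^Θ` is normal). [cite: MochizukiEtTh2009, Def 2.1 p.35] -/
theorem powTheta_normal : (D.powTheta l).Normal := by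
  refine ⟨fun x hx g => ?_⟩
  induction hx using Subgroup.closure_induction with
  | mem y hy =>
    obtain ⟨t, ht, rfl⟩ := hy
    have : g * t ^ l * g⁻¹ = (g * t * g⁻¹) ^ l := by rw [conj_pow]
    rw [this]
    exact D.pow_mem_powTheta l (D.dtpTheta_normal.conj_mem t ht g)
  | one => simp
  | mul y z _ _ hy hz =>
    have : g * (y * z) * g⁻¹ = (g * y * g⁻¹) * (g * z * g⁻¹) := by group
    rw [this]
    exact mul_mem hy hz
  | inv y _ hy =>
    have : g * y⁻¹ * g⁻¹ = (g * y * g⁻¹)⁻¹ := by group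
    rw [this]
    exact inv_mem hy

/-- **`⟨l-th powers⟩` absorbs commutators with `(Δ^tp_X)^Θ`**: `[q, d] ∈ ⟨l-th powers⟩` for
`q ∈ ⟨l-th powers⟩`, `d ∈ (Δ^tp_X)^Θ` — on generators `[t^l, d] = [t, d]^l` (class two), and the
property is stable under products and inverses by normality. Hence `Δ̄_X = (Δ^tp_X)^Θ/⟨l-th powers⟩`
is a CENTRAL quotient for the commutator pairing, as the printed exact sequence requires.
[cite: MochizukiEtTh2009, Def 2.1 p.35] -/
theorem commutator_mem_powTheta {q d : D.GtpTheta} (hq : q ∈ D.powTheta l) (hd : d ∈ D.DtpTheta) :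
    q * d * q⁻¹ * d⁻¹ ∈ D.powTheta l := by
  induction hq using Subgroup.closure_induction with
  | mem y hy =>
    obtain ⟨t, ht, rfl⟩ := hy
    change t ^ l * d * (t ^ l)⁻¹ * d⁻¹ ∈ D.powTheta l
    rw [D.commutator_pow_left ht hd l]
    exact D.pow_mem_powTheta l (D.deltaTheta_le_dtpTheta (D.commutator_mem_deltaTheta ht hd))
  | one => simp
  | mul y z hy' _ hy hz =>
    -- `[yz, d] = y [z,d] y⁻¹ · [y, d]`
    have e : y * z * d * (y * z)⁻¹ * d⁻¹ = (y * (z * d * z⁻¹ * d⁻¹) * y⁻¹) * (y * d * y⁻¹ * d⁻¹) := by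
      group
    rw [e]
    exact mul_mem ((D.powTheta_normal l).conj_mem _ hz y) hy
  | inv y hy' hy =>
    -- `[y⁻¹, d] = y⁻¹ [y,d]⁻¹ y`
    have e : y⁻¹ * d * y⁻¹⁻¹ * d⁻¹ = y⁻¹ * (y * d * y⁻¹ * d⁻¹)⁻¹ * y⁻¹⁻¹ := by group
    rw [e]
    exact (D.powTheta_normal l).conj_mem _ (inv_mem hy) y⁻¹

/-- `⟨l-th powers⟩ · Δ_Θ` is normal in `(Π^tp_X)^Θ`. [cite: MochizukiEtTh2009, Def 2.1 p.35] -/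
theorem powTheta_sup_deltaTheta_normal : (D.powTheta l ⊔ D.DeltaTheta).Normal := by
  haveI := D.powTheta_normal l
  exact Subgroup.sup_normal _ _

/-- `⟨l-th powers⟩ · Δ_Θ ⊆ (Δ^tp_X)^Θ`. [cite: MochizukiEtTh2009, Def 2.1 p.35] -/
theorem powTheta_sup_deltaTheta_le : D.powTheta l ⊔ D.DeltaTheta ≤ D.DtpTheta :=
  sup_le (D.powTheta_le_dtpTheta l) D.deltaTheta_le_dtpTheta

/-! ### `Ker(Δ^tp_X ↠ Δ̄_X)` and the preimage of `Δ̄_Θ`, inside `Π^tp_X` -/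

/-- **`Ker(Δ^tp_X ↠ Δ̄_X)`** as a subgroup of `Π^tp_X`: the elements of `Δ^tp_X` whose image in
`(Π^tp_X)^Θ` lies in `⟨l-th powers⟩` ("the kernel of the quotient `Δ_X ↠ Δ̄_X`", p. 35; the field
`CoverData.barKer` at the model, before transport to `Π_C`). [cite: MochizukiEtTh2009, Def 2.1 p.35] -/
def barKerTp : Subgroup D.PiTemp := D.DeltaTemp ⊓ (D.powTheta l).comap D.toTheta

/-- **The inverse image of `Δ̄_Θ ⊆ Δ̄_X` in `Δ^tp_X`** ("`1 → Δ̄_Θ → Δ̄_X → Δ̄^ell_X → 1`", p. 35): the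
elements of `Δ^tp_X` whose image in `(Π^tp_X)^Θ` lies in `⟨l-th powers⟩ · Δ_Θ` (the field
`CoverData.barTheta` at the model). [cite: MochizukiEtTh2009, Def 2.1 p.35] -/
def barThetaTp : Subgroup D.PiTemp := D.DeltaTemp ⊓ (D.powTheta l ⊔ D.DeltaTheta).comap D.toTheta

/-- Membership in `Ker(Δ^tp_X ↠ Δ̄_X)`. [cite: MochizukiEtTh2009, Def 2.1 p.35] -/
theorem mem_barKerTp_iff {x : D.PiTemp} :
    x ∈ D.barKerTp l ↔ x ∈ D.DeltaTemp ∧ D.toTheta x ∈ D.powTheta l := Iff.rfl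

/-- Membership in the preimage of `Δ̄_Θ`. [cite: MochizukiEtTh2009, Def 2.1 p.35] -/
theorem mem_barThetaTp_iff {x : D.PiTemp} :
    x ∈ D.barThetaTp l ↔ x ∈ D.DeltaTemp ∧ D.toTheta x ∈ D.powTheta l ⊔ D.DeltaTheta := Iff.rfl

/-- `Ker(Δ^tp_X ↠ Δ̄_X) ⊆` preimage of `Δ̄_Θ` (the field `CoverData.barKer_le_barTheta` at the model).
[cite: MochizukiEtTh2009, Def 2.1 p.35] -/
theorem barKerTp_le_barThetaTp : D.barKerTp l ≤ D.barThetaTp l :=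
  fun _ hx => ⟨hx.1, Subgroup.mem_sup_left hx.2⟩

/-- The preimage of `Δ̄_Θ` lies in `Δ^tp_X` (the field `CoverData.barTheta_le` at the model, tempered
form). [cite: MochizukiEtTh2009, Def 2.1 p.35] -/
theorem barThetaTp_le_deltaTemp : D.barThetaTp l ≤ D.DeltaTemp := fun _ hx => hx.1

/-- `Ker(Π^tp_X ↠ (Π^tp_X)^Θ) ⊆ Ker(Δ^tp_X ↠ Δ̄_X)`. [cite: MochizukiEtTh2009, Def 2.1 p.35] -/
theorem ker_toTheta_le_barKerTp : D.toTheta.ker ≤ D.barKerTp l := fun x hx =>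
  Subgroup.mem_inf.2 ⟨D.ker_toTheta_le_deltaTemp hx, Subgroup.mem_comap.2 (by
    rw [show D.toTheta x = 1 from hx]; exact one_mem _)⟩

/-- The preimage of `Δ_Θ` in `Δ^tp_X` lies in the preimage of `Δ̄_Θ`. [cite: MochizukiEtTh2009, Def 2.1 p.35] -/
theorem comap_deltaTheta_le_barThetaTp :
    D.DeltaTemp ⊓ D.DeltaTheta.comap D.toTheta ≤ D.barThetaTp l :=
  fun _ hx => ⟨hx.1, Subgroup.mem_sup_right hx.2⟩

/-- `Ker(Δ^tp_X ↠ Δ̄_X)` is normal in `Π^tp_X` (the field `CoverData.barKer_normal` at the model,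
tempered form). [cite: MochizukiEtTh2009, Def 2.1 p.35] -/
theorem barKerTp_normal : (D.barKerTp l).Normal := by
  haveI : D.DeltaTemp.Normal := MonoidHom.normal_ker D.aug.toMonoidHom
  haveI := (D.powTheta_normal l).comap D.toTheta
  exact Subgroup.normal_inf_normal _ _

/-- The preimage of `Δ̄_Θ` is normal in `Π^tp_X` (the field `CoverData.barTheta_normal` at the model,
tempered form). [cite: MochizukiEtTh2009, Def 2.1 p.35] -/
theorem barThetaTp_normal : (D.barThetaTp l).Normal := by
  haveI : D.DeltaTemp.Normal := MonoidHom.normal_ker D.aug.toMonoidHom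
  haveI := (D.powTheta_sup_deltaTheta_normal l).comap D.toTheta
  exact Subgroup.normal_inf_normal _ _

/-- **`d^l ∈ Ker(Δ^tp_X ↠ Δ̄_X)` for `d ∈ Δ^tp_X`** ("`Δ̄_X` = the quotient of `Δ^Θ_X` by the subgroup
generated by `l`-th powers", p. 35; the field `CoverDataAx.pow_mem_barKer` at the model).
[cite: MochizukiEtTh2009, Def 2.1 p.35] -/
theorem pow_mem_barKerTp {d : D.PiTemp} (hd : d ∈ D.DeltaTemp) : d ^ l ∈ D.barKerTp l :=
  Subgroup.mem_inf.2 ⟨pow_mem hd l, Subgroup.mem_comap.2 (by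
    rw [map_pow]
    exact D.pow_mem_powTheta l ⟨d, hd, rfl⟩)⟩

/-- **`Δ̄_Θ` is central in `Δ̄_X`** ("`Δ_Θ ⊆` the centre of `Δ^Θ_X`", p. 12, passes to the quotient because
`⟨l-th powers⟩` absorbs commutators): for `t` in the preimage of `Δ̄_Θ` and `d ∈ Δ^tp_X`,
`t d t⁻¹ d⁻¹ ∈ Ker(Δ^tp_X ↠ Δ̄_X)` (the field `CoverData.barTheta_central` at the model, tempered form).
[cite: MochizukiEtTh2009, Def 2.1 p.35] -/
theorem barThetaTp_central {t d : D.PiTemp} (ht : t ∈ D.barThetaTp l) (hd : d ∈ D.DeltaTemp) :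
    t * d * t⁻¹ * d⁻¹ ∈ D.barKerTp l := by
  have htΔ : t ∈ D.DeltaTemp := (D.mem_barThetaTp_iff l).1 ht |>.1
  have htΘ : D.toTheta t ∈ D.powTheta l ⊔ D.DeltaTheta := (D.mem_barThetaTp_iff l).1 ht |>.2
  refine (D.mem_barKerTp_iff l).2 ⟨?_, ?_⟩
  · exact mul_mem (mul_mem (mul_mem htΔ hd) (inv_mem htΔ)) (inv_mem hd)
  · rw [map_mul, map_mul, map_mul, map_inv, map_inv]
    have hdΘ : D.toTheta d ∈ D.DtpTheta := ⟨d, hd, rfl⟩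
    haveI := D.powTheta_normal l
    obtain ⟨q, hq, z, hz, hqz⟩ := Subgroup.mem_sup_of_normal_left.1 htΘ
    rw [← hqz]
    -- `[q z, d] = q (z d z⁻¹ d⁻¹) q⁻¹ · [q, d] = [q, d]` since `z ∈ Δ_Θ` is central
    have hzd : z * D.toTheta d * z⁻¹ * (D.toTheta d)⁻¹ = 1 := by
      rw [D.deltaTheta_comm_dtpTheta hz hdΘ]; group
    have e : q * z * D.toTheta d * (q * z)⁻¹ * (D.toTheta d)⁻¹ =
        q * (z * D.toTheta d * z⁻¹ * (D.toTheta d)⁻¹) * q⁻¹ * (q * D.toTheta d * q⁻¹ * (D.toTheta d)⁻¹) := by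
      group
    rw [e, hzd, mul_one, mul_inv_cancel, one_mul]
    exact D.commutator_mem_powTheta l hq hdΘ

/-- Commutators of `Δ^tp_X` lie in the preimage of `Δ̄_Θ` (indeed in the preimage of `Δ_Θ`): the quotient
`Δ̄^ell_X = Δ̄_X/Δ̄_Θ` is abelian. [cite: MochizukiEtTh2009, Def 2.1 p.35] -/
theorem commutator_mem_barThetaTp {x y : D.PiTemp} (hx : x ∈ D.DeltaTemp) (hy : y ∈ D.DeltaTemp) :
    x * y * x⁻¹ * y⁻¹ ∈ D.barThetaTp l := by
  refine D.comap_deltaTheta_le_barThetaTp l (Subgroup.mem_inf.2 ⟨?_, Subgroup.mem_comap.2 ?_⟩)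
  · exact mul_mem (mul_mem (mul_mem hx hy) (inv_mem hx)) (inv_mem hy)
  · rw [map_mul, map_mul, map_mul, map_inv, map_inv]
    exact D.commutator_mem_deltaTheta ⟨x, hx, rfl⟩ ⟨y, hy, rfl⟩

/-- `⁅Δ^tp_X, Δ^tp_X⁆ · Ker(Δ^tp_X ↠ Δ̄_X) ⊆` preimage of `Δ̄_Θ` — one inclusion of the printed
"`Δ_Θ` = the image of `∧² Δ^ell_X`" (p. 12) at the level of `Δ̄_X` (the hypothesis shape `hΘ` of
`TemperedCoverData.rmk261_of`, GAP-LEDGER G-L2d3-1, is the EQUALITY; its reverse inclusion needs the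
generation of `Δ_Θ` by commutators, `IsEtThOrigin`). [cite: MochizukiEtTh2009, Def 2.1 p.35] -/
theorem commutator_sup_barKerTp_le :
    ⁅D.DeltaTemp, D.DeltaTemp⁆ ⊔ D.barKerTp l ≤ D.barThetaTp l := by
  refine sup_le ?_ (D.barKerTp_le_barThetaTp l)
  refine Subgroup.commutator_le.2 fun x hx y hy => ?_
  rw [commutatorElement_def]
  exact D.commutator_mem_barThetaTp l hx hy

end ThetaSetting

end Literature.AnabelianGeometry.EtaleTheta

end
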